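import Literature.NumberTheory.ConnesConsani2021.SeriesRemainderBounds
import Literature.Analysis.FunctionSpaces.SmoothParametricIntegral
import Literature.Analysis.Calculus.FiniteOrderIntervalExtension
import Mathlib.MeasureTheory.Integral.IntervalIntegral.FundThmCalculus
import HarnessLib

/-!
# Connes–Consani 2021, Lemma 5.2 (arXiv Lemma 29): the truncated scaling coefficient
# `k(ρ) = ρ^{1/2}∫_{ρ⁻¹}^1 ξ(x)η(ρx)dx`, its regularity for `ρ ≥ 1`, its first derivative and
# `Qk` with the boundary terms — PROVED

RH-FREE corpus literature (label, line 1): one-variable calculus on the matrix coefficients of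
the scaling representation that make up the density `ε` of the functional `E` (§5); nothing in
this file mentions `ζ`, the critical strip or RH, and nothing here bears on the truth of RH.
bears_on (cell rh-crit, corpus C1): apex input (B) «density of `E`» — the `C²` regularity, the
value `k(1) = 0`, the right derivative `k′(1⁺) = ξ(1)η(1)` (the mechanism of Lemma 5.4's
`ε′(1₊) = Σ λ(n)²(1−λ(n)²)⁻¹ ξ_n(1)²`) and the formula for `Qk` (the mechanism of Prop. 5.3) of
each term of the series (sonine0) for `ε`, which — with the termwise bounds of Appendix E
(`SeriesRemainderBounds.lean`) and the closed-interval series / extension theorems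
(`Literature.Analysis.Calculus.contDiffOn_tsum_of_iteratedDerivWithin_le`,
`Literature.Analysis.Calculus.exists_contDiff_extension_Ici`) — is what the hypothesis
"`G ∈ C²(ℝ)`, `G′(0) = e′`" of
`MainInequalityAssembly.weilArchPositivity_soninTrace_fine_of_spectralData` is made of (route item
`DensityRegular`).

Source: A. Connes, C. Consani, *Weil positivity and trace formula, the archimedean place*, Selecta
Math. (N.S.) 27 (2021) 77 = arXiv:2006.13771 [bib `ConnesConsani2021`], §5 Lemma 5.2 (arXiv
running number Lemma 29; held text `paper:arxiv-2006.13771`, statement p0019:L77–L80, proof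
p0019:L82–p0020:L47).

## What is printed (Lemma 5.2 = arXiv Lemma 29, p0019:L77)

"Let `ξ ∈ C^∞((0,1])` and `η ∈ C^∞([1,∞))` be smooth and real valued functions.  Extend first
`ξ, η` to `[0,∞)` as follows: `ξ(x) := 0` for `x > 1` and `η(x) := 0` for `x < 1`.  Then, with `Q`
as in (Qop) [`Q = −(ρ∂_ρ)² + ¼`] and `k(ρ) = ρ^{1/2}∫_0^∞ ξ(x)η(ρx)dx`, for `ρ ∈ (1,2]`, one has
(devil3bis)
`(Qk)(ρ) = ρ^{1/2}∫_{ρ⁻¹}^1 (D_uξ)(x)(D_uη)(ρx)dx + ρ^{-1/2}(D_uξ)(ρ⁻¹)η(1)`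
`− ρ^{1/2}ξ(1)(D_uη)(ρ)`." (`D_u f(x) = x f′(x)`.)  *Proof* (p0019:L82–p0020:L47): "One has
`k(ρ) = ρ^{1/2}∫_{ρ⁻¹}^1 ξ(x)η(ρx)dx` … Furthermore
`(ρ∂_ρ)(ρ^{1/2}∫_{ρ⁻¹}^1 ξ(x)η(ρx)dx) = ½(ρ^{1/2}∫_{ρ⁻¹}^1 ξ(x)η(ρx)dx) + ρ^{-1/2}ξ(ρ⁻¹)η(1)`
`+ ρ^{1/2}∫_{ρ⁻¹}^1 ξ(x)(D_uη)(ρx)dx`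
… Iterating this formula … `(Qk)(ρ) = −ρ^{1/2}∫_{ρ⁻¹}^1 ξ(x)((D_u²+D_u)η)(ρx)dx − B`,
`B = ρ^{-1/2}ξ(ρ⁻¹)(D_uη)(1) − ρ^{-1/2}(D_uξ)(ρ⁻¹)η(1)` … The integration by parts, which gives the
adjoint of `D_u` as `−1−D_u`, is `∫_a^b D_u(f)g + ∫_a^b f((1+D_u)g) = bf(b)g(b) − af(a)g(a)` …
Hence we obtain (devil3bis)."

## How it is typed (tree vocabulary of `SeriesRemainderBounds.lean`)

`ξ : ℝ → ℝ` with `ContDiffOn ℝ 2 ξ (Icc (-1) 1)` (the regularity field of the tree's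
`IsProlateFunction 1 (2n)`; only the values of `ξ` on `(0, 1]` enter `k(ρ)` for `ρ ≥ 1`, and
`D_uξ` is the one-sided `scaleDerivIn ξ = x·ξ′_{[−1,1]}(x)`), `η : ℝ → ℝ` with `ContDiff ℝ 2 η`
(in §5, `η` is the Fourier transform `cosTransform ψ` of the cut-off prolate function, smooth on
`ℝ`; `D_uη = scaleDeriv η`).  Two derivatives are all that Lemma 5.2's displays use.  The
coefficient is written in the additive variable `x = log ρ ≥ 0` (`ρ∂_ρ = d/dx`, `Q = −d²/dx² + ¼`),
which is the variable of the density `G(x) = ε(eˣ)` in `JumpFormula.lean`: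
`g(x) = e^{x/2}∫_{e^{-x}}^1 ξ(t)η(eˣt)dt = k(eˣ)`.

* `exists_contDiff_truncScalingCoeff` — there is `g ∈ C²(ℝ)` with `g(x) = k(eˣ)` for `x ≥ 0`,
  `g(0) = 0`, `g′(0) = ξ(1)η(1)`, and for `x ≥ 0` the printed first-derivative display and the
  second derivative;
  second derivative in the form (devil3bis): for `x ≥ 0`, `ρ = eˣ`,
  `−g″(x) + ¼g(x) = √ρ∫_{ρ⁻¹}^1 scaleDerivIn ξ t · scaleDeriv η (ρt) dt`
  `+ (√ρ)⁻¹ scaleDerivIn ξ ρ⁻¹ · η 1 − √ρ ξ 1 · scaleDeriv η ρ`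
  (printed for `ρ ∈ (1, 2]`; proved for all `ρ ≥ 1`, at `ρ = 1` with the one-sided derivatives);
* `opQ_truncScalingCoeff_eq` — Lemma 5.2 literally, in the variable `ρ > 1`:
  `−ρ(ρk′)′ + ¼k = √ρ∫_{ρ⁻¹}^1 (D_uξ)(t)(D_uη)(ρt)dt + (√ρ)⁻¹(D_uξ)(ρ⁻¹)η(1) − √ρξ(1)(D_uη)(ρ)`.

Proof route (ours where it shortens the printed one): with a `C²` extension `ξ̃` of `ξ|[−1,1]`
(`exists_contDiff_extension_Icc`), `Ψ(a,p) := ∫_0^a ξ̃(t)η(pt)dt = a∫_0^1 ξ̃(as)η(pas)ds` is `C²`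
on `ℝ²` (finite-order differentiation under the integral sign, from the tree's
`hasFDerivAt_parametric_intervalIntegral`), with `∂_aΨ = ξ̃(a)η(pa)` (FTC) and
`∂_pΨ = ∫_0^a ξ̃(t)tη′(pt)dt` (dominated differentiation); `g(x) = e^{x/2}(Ψ(1,eˣ) − Ψ(e^{-x},eˣ))`
gives the `C²` function and, by the chain rule, the printed `(ρ∂_ρ)k` display; iterating it on
`η ↦ D_uη` and integrating by parts (Mathlib's `intervalIntegral.integral_mul_deriv_eq_deriv_mul`)
gives (devil3bis).  No named fact is introduced.
-/

noncomputable section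

open Real MeasureTheory Set Filter intervalIntegral Metric
open scoped Topology

namespace Literature.NumberTheory.ConnesConsani2021

open Literature.NumberTheory.LFunctions Literature.Analysis.Calculus
  Literature.Analysis.FunctionSpaces

/-! ## Finite-order differentiation under the integral sign over `[a, b]` -/

/-- `Cⁿ` dependence on a finite-dimensional parameter of `∫_a^b H(σ, p) dσ` for `H ∈ Cⁿ`, `n : ℕ`
(the finite-order form of the tree's `contDiff_parametric_intervalIntegral`; same induction).
[folklore] -/
private theorem contDiff_parametric_intervalIntegral_nat {P : Type*} [NormedAddCommGroup P]
    [NormedSpace ℝ P] [FiniteDimensional ℝ P] (a b : ℝ) :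
    ∀ (n : ℕ) {H : ℝ × P → ℝ}, ContDiff ℝ n H → ContDiff ℝ n fun p : P ↦ ∫ σ in a..b, H (σ, p)
  | 0, H, hH => by
    rw [Nat.cast_zero, contDiff_zero] at hH ⊢
    exact intervalIntegral.continuous_parametric_intervalIntegral_of_continuous'
      (f := fun p σ ↦ H (σ, p)) (hH.comp (continuous_snd.prodMk continuous_fst)) a b
  | n + 1, H, hH => by
    have h1 : (((n + 1 : ℕ) : ℕ∞) : WithTop ℕ∞) ≠ 0 := by simp
    rw [Nat.cast_succ, contDiff_succ_iff_fderiv_apply]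
    refine ⟨differentiable_parametric_intervalIntegral hH (by exact_mod_cast h1) a b,
      fun h ↦ ?_, fun v ↦ ?_⟩
    · exact absurd h (by exact_mod_cast WithTop.coe_ne_top)
    · have hv : (fun p : P ↦ fderiv ℝ (fun p : P ↦ ∫ σ in a..b, H (σ, p)) p v) =
          fun p : P ↦ ∫ σ in a..b, fderiv ℝ H (σ, p) ((0 : ℝ), v) :=
        funext fun p ↦ fderiv_parametric_intervalIntegral_apply hH (by exact_mod_cast h1) a b p v
      rw [hv]
      refine contDiff_parametric_intervalIntegral_nat a b n
        (H := fun q ↦ fderiv ℝ H q ((0 : ℝ), v)) ?_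
      exact (hH.fderiv_right (m := n) (by norm_cast)).clm_apply contDiff_const

/-! ## The auxiliary two-variable primitive `Ψ(a, p) = ∫_0^a ξ(t) η(p t) dt` -/

section Psi

variable {ξ η : ℝ → ℝ}

/-- `Ψ(a, p) = ∫_0^a ξ(t) η(pt) dt` as a function of `q = (a, p)`. Plumbing, private. [folklore] -/
private def psiAux (ξ η : ℝ → ℝ) (q : ℝ × ℝ) : ℝ :=
  ∫ t in (0 : ℝ)..q.1, ξ t * η (q.2 * t)

/-- `Ψ(a,p) = a ∫_0^1 ξ(as) η(pas) ds` (substitution `t = as`). [folklore] -/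
private theorem psi_eq_mul_integral (ξ η : ℝ → ℝ) (a p : ℝ) :
    ∫ t in (0 : ℝ)..a, ξ t * η (p * t) = a * ∫ s in (0 : ℝ)..1, ξ (a * s) * η (p * (a * s)) := by
  have h := intervalIntegral.smul_integral_comp_mul_left (fun t ↦ ξ t * η (p * t)) a
    (a := (0 : ℝ)) (b := 1)
  simp only [smul_eq_mul, mul_zero, mul_one] at h
  exact h.symm

/-- `Ψ` is `Cⁿ` jointly in `(a, p)` when `ξ, η ∈ Cⁿ(ℝ)`. [folklore] -/
private theorem contDiff_psi {n : ℕ} (hξ : ContDiff ℝ n ξ) (hη : ContDiff ℝ n η) :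
    ContDiff ℝ n (psiAux ξ η) := by
  have hH : ContDiff ℝ n fun z : ℝ × (ℝ × ℝ) ↦ ξ (z.2.1 * z.1) * η (z.2.2 * (z.2.1 * z.1)) :=
    (hξ.comp (contDiff_snd.fst.mul contDiff_fst)).mul
      (hη.comp (contDiff_snd.snd.mul (contDiff_snd.fst.mul contDiff_fst)))
  have hI := contDiff_parametric_intervalIntegral_nat (P := ℝ × ℝ) 0 1 n hH
  have e : psiAux ξ η =
      fun q : ℝ × ℝ ↦ q.1 * ∫ s in (0 : ℝ)..1, ξ (q.1 * s) * η (q.2 * (q.1 * s)) := by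
    funext q
    exact psi_eq_mul_integral ξ η q.1 q.2
  rw [e]
  exact contDiff_fst.mul hI

/-- `∂Ψ/∂a (a, p) = ξ(a) η(pa)` (fundamental theorem of calculus). [folklore] -/
private theorem hasDerivAt_psi_fst (hξ : Continuous ξ) (hη : Continuous η) (a p : ℝ) :
    HasDerivAt (fun a ↦ psiAux ξ η (a, p)) (ξ a * η (p * a)) a := by
  have hc : Continuous fun t ↦ ξ t * η (p * t) :=
    hξ.mul (hη.comp (continuous_const.mul continuous_id))
  show HasDerivAt (fun u ↦ ∫ t in (0 : ℝ)..u, ξ t * η (p * t)) (ξ a * η (p * a)) a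
  exact intervalIntegral.integral_hasDerivAt_right (hc.intervalIntegrable _ _)
    (hc.stronglyMeasurableAtFilter _ _) hc.continuousAt

/-- `∂Ψ/∂p (a, p) = ∫_0^a ξ(t) t η′(pt) dt` (differentiation under the integral sign, the
derivative being bounded on `[0, a] × B(p, 1)`). [folklore] -/
private theorem hasDerivAt_psi_snd (hξ : Continuous ξ) (hη : ContDiff ℝ 1 η) (a p : ℝ) :
    HasDerivAt (fun p ↦ psiAux ξ η (a, p))
      (∫ t in (0 : ℝ)..a, ξ t * (t * deriv η (p * t))) p := by
  have hηc : Continuous η := hη.continuous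
  have hη'c : Continuous (deriv η) := hη.continuous_deriv le_rfl
  have hηd : ∀ y, HasDerivAt η (deriv η y) y := fun y ↦
    (hη.differentiable one_ne_zero y).hasDerivAt
  -- a uniform bound for the derivative on `closedBall p 1 × uIcc 0 a`
  have hF'c : Continuous fun z : ℝ × ℝ ↦ ξ z.2 * (z.2 * deriv η (z.1 * z.2)) :=
    (hξ.comp continuous_snd).mul
      (continuous_snd.mul (hη'c.comp (continuous_fst.mul continuous_snd)))
  obtain ⟨C, hC⟩ : ∃ C, ∀ z ∈ closedBall p 1 ×ˢ uIcc (0 : ℝ) a,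
      ‖ξ z.2 * (z.2 * deriv η (z.1 * z.2))‖ ≤ C :=
    ((isCompact_closedBall p 1).prod isCompact_uIcc).exists_bound_of_continuousOn hF'c.continuousOn
  have h := intervalIntegral.hasDerivAt_integral_of_dominated_loc_of_deriv_le
    (F := fun p t ↦ ξ t * η (p * t)) (F' := fun p t ↦ ξ t * (t * deriv η (p * t)))
    (x₀ := p) (a := 0) (b := a) (bound := fun _ ↦ C) (μ := volume) (ball_mem_nhds p one_pos)
    ?_ ?_ ?_ ?_ ?_ ?_
  · exact h.2
  · exact Eventually.of_forall fun q ↦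
      ((hξ.mul (hηc.comp (continuous_const.mul continuous_id))).aestronglyMeasurable)
  · exact (hξ.mul (hηc.comp (continuous_const.mul continuous_id))).intervalIntegrable _ _
  · exact (hξ.mul (continuous_id.mul (hη'c.comp (continuous_const.mul continuous_id))))
      |>.aestronglyMeasurable
  · refine Eventually.of_forall fun t ht q hq ↦ hC (q, t) ⟨?_, uIoc_subset_uIcc ht⟩
    exact mem_closedBall.2 (le_of_lt (mem_ball.1 hq))
  · exact intervalIntegrable_const
  · refine Eventually.of_forall fun t _ q _ ↦ ?_
    have h1 : HasDerivAt (fun q ↦ η (q * t)) (deriv η (q * t) * t) q := by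
      have := (hηd (q * t)).comp q ((hasDerivAt_id q).mul_const t)
      simpa [Function.comp_def] using this
    have h2 := h1.const_mul (ξ t)
    simpa [mul_comm t, mul_assoc, mul_left_comm] using h2

/-- The Fréchet derivative of `Ψ` in terms of its two partial derivatives. [folklore] -/
private theorem fderiv_psi_apply (hξ : ContDiff ℝ 1 ξ) (hη : ContDiff ℝ 1 η) (a p h k : ℝ) :
    fderiv ℝ (psiAux ξ η) (a, p) (h, k) =
      h * (ξ a * η (p * a)) + k * ∫ t in (0 : ℝ)..a, ξ t * (t * deriv η (p * t)) := by
  have hd : HasFDerivAt (psiAux ξ η) (fderiv ℝ (psiAux ξ η) (a, p)) (a, p) :=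
    ((contDiff_psi (n := 1) hξ hη).differentiable one_ne_zero _).hasFDerivAt
  -- the two partial derivatives as values of `fderiv Ψ`
  have h1 : HasDerivAt (fun s ↦ psiAux ξ η (s, p)) (fderiv ℝ (psiAux ξ η) (a, p) (1, 0)) a := by
    have h := hd.comp_hasDerivAt a ((hasDerivAt_id' a).prodMk (hasDerivAt_const a p))
    simpa only [Function.comp_def] using h
  have h1' : HasDerivAt (fun s ↦ psiAux ξ η (s, p)) (ξ a * η (p * a)) a :=
    hasDerivAt_psi_fst hξ.continuous hη.continuous a p
  have h2 : HasDerivAt (fun s ↦ psiAux ξ η (a, s)) (fderiv ℝ (psiAux ξ η) (a, p) (0, 1)) p := by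
    have h := hd.comp_hasDerivAt p ((hasDerivAt_const p a).prodMk (hasDerivAt_id' p))
    simpa only [Function.comp_def] using h
  have h2' : HasDerivAt (fun s ↦ psiAux ξ η (a, s))
      (∫ t in (0 : ℝ)..a, ξ t * (t * deriv η (p * t))) p :=
    hasDerivAt_psi_snd hξ.continuous hη a p
  have e : ((h, k) : ℝ × ℝ) = h • ((1 : ℝ), (0 : ℝ)) + k • ((0 : ℝ), (1 : ℝ)) := by
    ext <;> simp
  rw [e, map_add, map_smul, map_smul, h1.unique h1', h2.unique h2', smul_eq_mul, smul_eq_mul]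

end Psi

/-! ## The coefficient in the additive variable: `g(x) = e^{x/2}∫_{e^{-x}}^1 ξ(t)η(eˣt)dt` -/

section Coefficient

variable {ξ η : ℝ → ℝ}

/-- The expression `e^{x/2}∫_{e^{-x}}^1 ξ(t)η(eˣt)dt` as a function on all of `ℝ` (for a globally
defined `ξ`; it is `k(eˣ)` of Lemma 5.2 when `x ≥ 0`). Plumbing, private. [folklore] -/
private def gExt (ξ η : ℝ → ℝ) (x : ℝ) : ℝ :=
  Real.exp (x / 2) * ∫ t in Real.exp (-x)..1, ξ t * η (Real.exp x * t)

/-- The boundary term `e^{-x/2} ξ(e^{-x}) η(1)` of the first-derivative display. Plumbing,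
private. [folklore] -/
private def bTerm (ξ η : ℝ → ℝ) (x : ℝ) : ℝ :=
  Real.exp (-x / 2) * ξ (Real.exp (-x)) * η 1

/-- `eˣ · e⁻ˣ = 1`. [folklore] -/
private theorem exp_mul_exp_neg (x : ℝ) : Real.exp x * Real.exp (-x) = 1 := by
  rw [← Real.exp_add, add_neg_cancel, Real.exp_zero]

/-- `e^{x/2} · e⁻ˣ = e^{-x/2}`. [folklore] -/
private theorem exp_half_mul_exp_neg (x : ℝ) :
    Real.exp (x / 2) * Real.exp (-x) = Real.exp (-x / 2) := by
  rw [← Real.exp_add]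
  congr 1
  ring

/-- `g(x) = e^{x/2}(Ψ(1, eˣ) − Ψ(e^{-x}, eˣ))`. [folklore] -/
private theorem gExt_eq_psi (hξ : Continuous ξ) (hη : Continuous η) (x : ℝ) :
    gExt ξ η x = Real.exp (x / 2) *
      (psiAux ξ η (1, Real.exp x) - psiAux ξ η (Real.exp (-x), Real.exp x)) := by
  have hc : Continuous fun t ↦ ξ t * η (Real.exp x * t) :=
    hξ.mul (hη.comp (continuous_const.mul continuous_id))
  rw [gExt, psiAux, psiAux, intervalIntegral.integral_interval_sub_left (hc.intervalIntegrable _ _)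
    (hc.intervalIntegrable _ _)]

/-- `g` is `Cⁿ` on `ℝ` when `ξ, η ∈ Cⁿ(ℝ)`. [folklore] -/
private theorem contDiff_gExt {n : ℕ} (hξ : ContDiff ℝ n ξ) (hη : ContDiff ℝ n η) :
    ContDiff ℝ n (gExt ξ η) := by
  have e : gExt ξ η = fun x ↦ Real.exp (x / 2) *
      (psiAux ξ η (1, Real.exp x) - psiAux ξ η (Real.exp (-x), Real.exp x)) := by
    funext x
    exact gExt_eq_psi hξ.continuous hη.continuous x
  rw [e]
  have hΨ := contDiff_psi hξ hη
  refine (Real.contDiff_exp.comp (contDiff_id.div_const 2)).mul ?_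
  exact (hΨ.comp (contDiff_const.prodMk (Real.contDiff_exp.comp contDiff_id))).sub
    (hΨ.comp ((Real.contDiff_exp.comp contDiff_neg).prodMk (Real.contDiff_exp.comp contDiff_id)))

/-- `eˣ ∫ ξ(t) t η′(eˣt) dt = ∫ ξ(t) (D_uη)(eˣt) dt`. [folklore] -/
private theorem exp_mul_integral_eq_integral_scaleDeriv (ξ η : ℝ → ℝ) (x a b : ℝ) :
    Real.exp x * ∫ t in a..b, ξ t * (t * deriv η (Real.exp x * t))
      = ∫ t in a..b, ξ t * scaleDeriv η (Real.exp x * t) := by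
  rw [← intervalIntegral.integral_const_mul]
  refine intervalIntegral.integral_congr fun t _ ↦ ?_
  simp only [scaleDeriv]
  ring

/-- **The first-derivative display of the proof of Lemma 5.2** (p0019:L80), for globally `C¹`
data: `g′ = ½g + g[ξ, D_uη] + e^{-x/2}ξ(e^{-x})η(1)`, i.e.
`(ρ∂_ρ)k = ½k + ρ^{1/2}∫_{ρ⁻¹}^1 ξ(t)(D_uη)(ρt)dt + ρ^{-1/2}ξ(ρ⁻¹)η(1)`. [folklore] -/
private theorem hasDerivAt_gExt (hξ : ContDiff ℝ 1 ξ) (hη : ContDiff ℝ 1 η) (x : ℝ) :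
    HasDerivAt (gExt ξ η) (gExt ξ η x / 2 + gExt ξ (scaleDeriv η) x + bTerm ξ η x) x := by
  have hd : ∀ q, HasFDerivAt (psiAux ξ η) (fderiv ℝ (psiAux ξ η) q) q := fun q ↦
    ((contDiff_psi (n := 1) hξ hη).differentiable one_ne_zero q).hasFDerivAt
  have hem : HasDerivAt (fun x ↦ Real.exp (-x)) (-Real.exp (-x)) x := by
    simpa [Function.comp_def] using (Real.hasDerivAt_exp (-x)).comp x (hasDerivAt_neg x)
  have hA : HasDerivAt (fun x ↦ psiAux ξ η (1, Real.exp x))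
      (fderiv ℝ (psiAux ξ η) (1, Real.exp x) (0, Real.exp x)) x := by
    have h := (hd _).comp_hasDerivAt x
      ((hasDerivAt_const x (1 : ℝ)).prodMk (Real.hasDerivAt_exp x))
    simpa only [Function.comp_def] using h
  have hB : HasDerivAt (fun x ↦ psiAux ξ η (Real.exp (-x), Real.exp x))
      (fderiv ℝ (psiAux ξ η) (Real.exp (-x), Real.exp x) (-Real.exp (-x), Real.exp x)) x := by
    have h := (hd _).comp_hasDerivAt x (hem.prodMk (Real.hasDerivAt_exp x))
    simpa only [Function.comp_def] using h
  have hh : HasDerivAt (fun x ↦ Real.exp (x / 2)) (Real.exp (x / 2) * (1 / 2)) x :=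
    ((hasDerivAt_id x).div_const 2).exp
  have hprod : HasDerivAt (fun y ↦ Real.exp (y / 2) *
      (psiAux ξ η (1, Real.exp y) - psiAux ξ η (Real.exp (-y), Real.exp y)))
      (Real.exp (x / 2) * (1 / 2) *
          (psiAux ξ η (1, Real.exp x) - psiAux ξ η (Real.exp (-x), Real.exp x))
        + Real.exp (x / 2) *
          (fderiv ℝ (psiAux ξ η) (1, Real.exp x) (0, Real.exp x)
            - fderiv ℝ (psiAux ξ η) (Real.exp (-x), Real.exp x) (-Real.exp (-x), Real.exp x))) x :=
    hh.mul (hA.sub hB)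
  have e : gExt ξ η = fun y ↦ Real.exp (y / 2) *
      (psiAux ξ η (1, Real.exp y) - psiAux ξ η (Real.exp (-y), Real.exp y)) := by
    funext y
    exact gExt_eq_psi hξ.continuous hη.continuous y
  rw [e]
  refine hprod.congr_deriv ?_
  -- evaluate the partial derivatives and simplify
  have hc1 : Continuous fun t ↦ ξ t * (t * deriv η (Real.exp x * t)) :=
    hξ.continuous.mul (continuous_id.mul ((hη.continuous_deriv le_rfl).comp
      (continuous_const.mul continuous_id)))
  have hsplit : (∫ t in (0 : ℝ)..1, ξ t * (t * deriv η (Real.exp x * t)))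
      - ∫ t in (0 : ℝ)..Real.exp (-x), ξ t * (t * deriv η (Real.exp x * t))
      = ∫ t in Real.exp (-x)..1, ξ t * (t * deriv η (Real.exp x * t)) :=
    intervalIntegral.integral_interval_sub_left (hc1.intervalIntegrable _ _)
      (hc1.intervalIntegrable _ _)
  have hsd : gExt ξ (scaleDeriv η) x = Real.exp (x / 2) *
      (Real.exp x * ∫ t in Real.exp (-x)..1, ξ t * (t * deriv η (Real.exp x * t))) := by
    rw [gExt, exp_mul_integral_eq_integral_scaleDeriv]
  beta_reduce
  rw [fderiv_psi_apply hξ hη, fderiv_psi_apply hξ hη, hsd, bTerm, exp_mul_exp_neg,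
    ← exp_half_mul_exp_neg, ← hsplit]
  simp only [psiAux]
  ring

/-- For a `C²` function, `f′` is `C¹`. [folklore] -/
private theorem contDiff_one_deriv {f : ℝ → ℝ} (hf : ContDiff ℝ 2 f) : ContDiff ℝ 1 (deriv f) := by
  rw [← one_add_one_eq_two] at hf
  exact hf.deriv'

/-- `D_u f = x f′` is `C¹` for `f ∈ C²`. [folklore] -/
private theorem contDiff_one_scaleDeriv {f : ℝ → ℝ} (hf : ContDiff ℝ 2 f) :
    ContDiff ℝ 1 (scaleDeriv f) :=
  contDiff_id.mul (contDiff_one_deriv hf)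

/-- `D_u f` is continuous for `f ∈ C¹`. [folklore] -/
private theorem continuous_scaleDeriv {f : ℝ → ℝ} (hf : ContDiff ℝ 1 f) :
    Continuous (scaleDeriv f) :=
  continuous_id.mul (hf.continuous_deriv le_rfl)

/-- The derivative of the boundary term: `b′ = −½b − e^{-x/2}(D_uξ)(e^{-x})η(1)`. [folklore] -/
private theorem hasDerivAt_bTerm (hξ : ContDiff ℝ 1 ξ) (η : ℝ → ℝ) (x : ℝ) :
    HasDerivAt (bTerm ξ η)
      (-(bTerm ξ η x) / 2 - Real.exp (-x / 2) * scaleDeriv ξ (Real.exp (-x)) * η 1) x := by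
  have hem : HasDerivAt (fun x ↦ Real.exp (-x)) (-Real.exp (-x)) x := by
    simpa [Function.comp_def] using (Real.hasDerivAt_exp (-x)).comp x (hasDerivAt_neg x)
  have heh : HasDerivAt (fun x ↦ Real.exp (-x / 2)) (Real.exp (-x / 2) * (-1 / 2)) x := by
    have h := ((hasDerivAt_neg x).div_const 2).exp
    simpa [neg_div] using h
  have hξd : HasDerivAt (fun x ↦ ξ (Real.exp (-x))) (deriv ξ (Real.exp (-x)) * -Real.exp (-x)) x :=
    ((hξ.differentiable one_ne_zero _).hasDerivAt).comp x hem
  have h := (heh.mul hξd).mul_const (η 1)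
  refine h.congr_deriv ?_
  simp only [bTerm, scaleDeriv]
  ring

/-- **`Qg` before the integration by parts** (p0020:L24–L33:
"`(Qk)(ρ) = −ρ^{1/2}∫ξ((D_u²+D_u)η)(ρx)dx − B`,
`B = ρ^{-1/2}ξ(ρ⁻¹)(D_uη)(1) − ρ^{-1/2}(D_uξ)(ρ⁻¹)η(1)`"), for globally `C²` data. [folklore] -/
private theorem opQ_gExt (hξ : ContDiff ℝ 2 ξ) (hη : ContDiff ℝ 2 η) (x : ℝ) :
    -deriv (deriv (gExt ξ η)) x + gExt ξ η x / 4 =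
      -(gExt ξ (scaleDeriv η) x + gExt ξ (scaleDeriv (scaleDeriv η)) x)
        - bTerm ξ (scaleDeriv η) x + Real.exp (-x / 2) * scaleDeriv ξ (Real.exp (-x)) * η 1 := by
  have hξ1 : ContDiff ℝ 1 ξ := hξ.of_le (by norm_num)
  have hη1 : ContDiff ℝ 1 η := hη.of_le (by norm_num)
  have hη₁ : ContDiff ℝ 1 (scaleDeriv η) := contDiff_one_scaleDeriv hη
  -- `g′ = ½g + g₁ + b`
  have hd1 : deriv (gExt ξ η) = fun x ↦ gExt ξ η x / 2 + gExt ξ (scaleDeriv η) x + bTerm ξ η x :=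
    funext fun x ↦ (hasDerivAt_gExt hξ1 hη1 x).deriv
  -- differentiate once more
  have hd2 : HasDerivAt (deriv (gExt ξ η))
      ((gExt ξ η x / 2 + gExt ξ (scaleDeriv η) x + bTerm ξ η x) / 2
        + (gExt ξ (scaleDeriv η) x / 2 + gExt ξ (scaleDeriv (scaleDeriv η)) x
            + bTerm ξ (scaleDeriv η) x)
        + (-(bTerm ξ η x) / 2 - Real.exp (-x / 2) * scaleDeriv ξ (Real.exp (-x)) * η 1)) x := by
    rw [hd1]
    exact (((hasDerivAt_gExt hξ1 hη1 x).div_const 2).add (hasDerivAt_gExt hξ1 hη₁ x)).add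
      (hasDerivAt_bTerm hξ1 η x)
  rw [hd2.deriv]
  ring

/-- **The integration by parts of the proof of Lemma 5.2** (p0020:L38–L44: "the adjoint of `D_u`
is `−1−D_u` … `∫_a^b D_u(f)g + ∫_a^b f((1+D_u)g) = bf(b)g(b) − af(a)g(a)` … with `f = ξ`,
`g(x) = D_uη(ρx)`"). [folklore] -/
private theorem integral_scaleDeriv_mul_add (hξ : ContDiff ℝ 1 ξ) (hη : ContDiff ℝ 2 η)
    (ρ a b : ℝ) :
    (∫ t in a..b, scaleDeriv ξ t * scaleDeriv η (ρ * t))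
      + ∫ t in a..b, ξ t * (scaleDeriv η (ρ * t) + scaleDeriv (scaleDeriv η) (ρ * t))
      = b * ξ b * scaleDeriv η (ρ * b) - a * ξ a * scaleDeriv η (ρ * a) := by
  have hη₁ : ContDiff ℝ 1 (scaleDeriv η) := contDiff_one_scaleDeriv hη
  have hξd : ∀ t, HasDerivAt ξ (deriv ξ t) t := fun t ↦ (hξ.differentiable one_ne_zero t).hasDerivAt
  have hη₁d : ∀ y, HasDerivAt (scaleDeriv η) (deriv (scaleDeriv η) y) y := fun y ↦
    (hη₁.differentiable one_ne_zero y).hasDerivAt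
  -- `P(t) = t ξ(t) (D_uη)(ρt)` and its derivative
  have hP : ∀ t, HasDerivAt (fun t ↦ t * ξ t * scaleDeriv η (ρ * t))
      (scaleDeriv ξ t * scaleDeriv η (ρ * t)
        + ξ t * (scaleDeriv η (ρ * t) + scaleDeriv (scaleDeriv η) (ρ * t))) t := by
    intro t
    have h3 : HasDerivAt (fun t ↦ scaleDeriv η (ρ * t)) (deriv (scaleDeriv η) (ρ * t) * ρ) t := by
      have := (hη₁d (ρ * t)).comp t ((hasDerivAt_id t).const_mul ρ)
      simpa [Function.comp_def, mul_comm] using this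
    have h := ((hasDerivAt_id t).mul (hξd t)).mul h3
    refine h.congr_deriv ?_
    simp only [scaleDeriv, Pi.mul_apply, id_eq]
    ring
  have hc : Continuous fun t ↦ scaleDeriv ξ t * scaleDeriv η (ρ * t)
      + ξ t * (scaleDeriv η (ρ * t) + scaleDeriv (scaleDeriv η) (ρ * t)) := by
    have h1 := continuous_scaleDeriv hξ
    have h2 := continuous_scaleDeriv hη₁
    have h3 : Continuous (scaleDeriv η) := hη₁.continuous
    have hm : Continuous fun t : ℝ ↦ ρ * t := continuous_const.mul continuous_id
    exact (h1.mul (h3.comp hm)).add (hξ.continuous.mul ((h3.comp hm).add (h2.comp hm)))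
  have hftc := intervalIntegral.integral_eq_sub_of_hasDerivAt (fun t _ ↦ hP t)
    (hc.intervalIntegrable a b)
  have hm : Continuous fun t : ℝ ↦ ρ * t := continuous_const.mul continuous_id
  have hi1 : IntervalIntegrable (fun t ↦ scaleDeriv ξ t * scaleDeriv η (ρ * t)) volume a b := by
    have h : Continuous fun t ↦ scaleDeriv ξ t * scaleDeriv η (ρ * t) :=
      (continuous_scaleDeriv hξ).mul (hη₁.continuous.comp hm)
    exact h.intervalIntegrable a b
  have hi2 : IntervalIntegrable
      (fun t ↦ ξ t * (scaleDeriv η (ρ * t) + scaleDeriv (scaleDeriv η) (ρ * t))) volume a b := by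
    have h : Continuous fun t ↦ ξ t * (scaleDeriv η (ρ * t) + scaleDeriv (scaleDeriv η) (ρ * t)) :=
      hξ.continuous.mul ((hη₁.continuous.comp hm).add ((continuous_scaleDeriv hη₁).comp hm))
    exact h.intervalIntegrable a b
  rw [← intervalIntegral.integral_add hi1 hi2]
  exact hftc

/-- **(devil3bis) for globally `C²` data**:
`Qg = √ρ∫(D_uξ)(D_uη)(ρ·) + ρ^{-1/2}(D_uξ)(ρ⁻¹)η(1) − √ρξ(1)(D_uη)(ρ)` at `ρ = eˣ`. [folklore] -/
private theorem opQ_gExt_eq (hξ : ContDiff ℝ 2 ξ) (hη : ContDiff ℝ 2 η) (x : ℝ) :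
    -deriv (deriv (gExt ξ η)) x + gExt ξ η x / 4 =
      Real.exp (x / 2) * (∫ t in Real.exp (-x)..1, scaleDeriv ξ t * scaleDeriv η (Real.exp x * t))
        + Real.exp (-x / 2) * scaleDeriv ξ (Real.exp (-x)) * η 1
        - Real.exp (x / 2) * ξ 1 * scaleDeriv η (Real.exp x) := by
  have hξ1 : ContDiff ℝ 1 ξ := hξ.of_le (by norm_num)
  have hη₁ : ContDiff ℝ 1 (scaleDeriv η) := contDiff_one_scaleDeriv hη
  rw [opQ_gExt hξ hη]
  have hibp := integral_scaleDeriv_mul_add hξ1 hη (Real.exp x) (Real.exp (-x)) 1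
  rw [exp_mul_exp_neg, one_mul, mul_one] at hibp
  -- combine `g₁ + g₂` into one integral
  have hm : Continuous fun t : ℝ ↦ Real.exp x * t := continuous_const.mul continuous_id
  have hc1 : Continuous fun t ↦ ξ t * scaleDeriv η (Real.exp x * t) :=
    hξ.continuous.mul (hη₁.continuous.comp hm)
  have hc2 : Continuous fun t ↦ ξ t * scaleDeriv (scaleDeriv η) (Real.exp x * t) :=
    hξ.continuous.mul ((continuous_scaleDeriv hη₁).comp hm)
  have hsum : gExt ξ (scaleDeriv η) x + gExt ξ (scaleDeriv (scaleDeriv η)) x =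
      Real.exp (x / 2) * ∫ t in Real.exp (-x)..1,
        ξ t * (scaleDeriv η (Real.exp x * t) + scaleDeriv (scaleDeriv η) (Real.exp x * t)) := by
    simp only [gExt]
    rw [← mul_add, ← intervalIntegral.integral_add (hc1.intervalIntegrable _ _)
      (hc2.intervalIntegrable _ _)]
    congr 1
    refine intervalIntegral.integral_congr fun t _ ↦ ?_
    ring
  rw [hsum]
  -- substitute the integration by parts
  have hI : (∫ t in Real.exp (-x)..1,
      ξ t * (scaleDeriv η (Real.exp x * t) + scaleDeriv (scaleDeriv η) (Real.exp x * t)))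
      = ξ 1 * scaleDeriv η (Real.exp x)
        - Real.exp (-x) * ξ (Real.exp (-x)) * scaleDeriv η 1
        - ∫ t in Real.exp (-x)..1, scaleDeriv ξ t * scaleDeriv η (Real.exp x * t) := by
    linarith [hibp]
  rw [hI, bTerm, ← exp_half_mul_exp_neg]
  ring

end Coefficient

/-! ## The public statements: data `C²` on `[−1, 1]` only (the prolate regularity) -/

section Public

variable {ξ η : ℝ → ℝ}

/-- For `x ≥ 0` the integration range `[e^{-x}, 1]` lies in `[−1, 1]`. [folklore] -/
private theorem uIcc_exp_neg_subset {x : ℝ} (hx : 0 ≤ x) :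
    uIcc (Real.exp (-x)) 1 ⊆ Icc (-1 : ℝ) 1 := by
  have h1 : Real.exp (-x) ≤ 1 := Real.exp_le_one_iff.2 (by linarith)
  rw [uIcc_of_le h1]
  intro t ht
  exact ⟨by linarith [ht.1, Real.exp_pos (-x)], ht.2⟩

/-- For `x ≥ 0`, `e^{-x} ∈ [−1, 1]`. [folklore] -/
private theorem exp_neg_mem_Icc {x : ℝ} (hx : 0 ≤ x) : Real.exp (-x) ∈ Icc (-1 : ℝ) 1 :=
  ⟨by linarith [Real.exp_pos (-x)], Real.exp_le_one_iff.2 (by linarith)⟩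

/-- **Connes–Consani 2021, Lemma 5.2 (arXiv Lemma 29) with the displays of its proof — the
truncated scaling coefficient is `C²`, vanishes at `ρ = 1` with right derivative `ξ(1)η(1)`, and
has the printed `(ρ∂_ρ)k` and `Qk`.**  Let `ξ` be `C²` on `[−1, 1]` (within; only its values on
`(0, 1]` matter) and `η ∈ C²(ℝ)`.  Then there is `g ∈ C²(ℝ)` with, for all `x ≥ 0` and
`ρ = eˣ ≥ 1`: `g(x) = k(ρ) = ρ^{1/2}∫_{ρ⁻¹}^1 ξ(t)η(ρt)dt`; `g(0) = k(1) = 0`;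
`g′(0) = ξ(1)η(1)` (the jump mechanism behind Lemma 5.4's `ε′(1₊) = Σ λ(n)²(1−λ(n)²)⁻¹ξ_n(1)²`);
the display (p0019:L80)
`g′(x) = (ρ∂_ρ)k = ½k + ρ^{1/2}∫_{ρ⁻¹}^1 ξ(t)(D_uη)(ρt)dt + ρ^{-1/2}ξ(ρ⁻¹)η(1)`; and (devil3bis)
`(Qk)(ρ) = −g″(x) + ¼g(x)`
`= ρ^{1/2}∫_{ρ⁻¹}^1 (D_uξ)(t)(D_uη)(ρt)dt + ρ^{-1/2}(D_uξ)(ρ⁻¹)η(1) − ρ^{1/2}ξ(1)(D_uη)(ρ)`,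
with `D_uξ = scaleDerivIn ξ` (one-sided within `[−1,1]`, as printed: "`ξ ∈ C^∞((0,1])`") and
`D_uη = scaleDeriv η`.  Printed for `ρ ∈ (1, 2]` and smooth data; two derivatives are what the
proof uses, and the identities hold for every `ρ ≥ 1`.
[cite: ConnesConsani2021, Lemma 5.2 §5 p. 19 (arXiv Lemma 29, p0019:L77–L80;
proof p0019:L82–p0020:L47)] -/
theorem exists_contDiff_truncScalingCoeff (hξ : ContDiffOn ℝ 2 ξ (Icc (-1) 1))
    (hη : ContDiff ℝ 2 η) :
    ∃ g : ℝ → ℝ, ContDiff ℝ 2 g ∧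
      (∀ x, 0 ≤ x →
        g x = Real.exp (x / 2) * ∫ t in Real.exp (-x)..1, ξ t * η (Real.exp x * t)) ∧
      g 0 = 0 ∧ deriv g 0 = ξ 1 * η 1 ∧
      (∀ x, 0 ≤ x →
        deriv g x = g x / 2
          + Real.exp (x / 2) * (∫ t in Real.exp (-x)..1, ξ t * scaleDeriv η (Real.exp x * t))
          + Real.exp (-x / 2) * ξ (Real.exp (-x)) * η 1) ∧
      (∀ x, 0 ≤ x →
        -deriv (deriv g) x + g x / 4 =
          Real.exp (x / 2) *
              (∫ t in Real.exp (-x)..1, scaleDerivIn ξ t * scaleDeriv η (Real.exp x * t))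
            + Real.exp (-x / 2) * scaleDerivIn ξ (Real.exp (-x)) * η 1
            - Real.exp (x / 2) * ξ 1 * scaleDeriv η (Real.exp x)) := by
  obtain ⟨ξ', hξ', hEq, hD⟩ :=
    exists_contDiff_extension_Icc (N := 2) (show (-1 : ℝ) < 1 by norm_num) hξ
  have hξ'1 : ContDiff ℝ 1 ξ' := hξ'.of_le (by norm_num)
  have hη1 : ContDiff ℝ 1 η := hη.of_le (by norm_num)
  -- on `[−1, 1]`: `ξ' = ξ` and `D_uξ' = scaleDerivIn ξ`
  have hsD : ∀ t ∈ Icc (-1 : ℝ) 1, scaleDeriv ξ' t = scaleDerivIn ξ t := by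
    intro t ht
    have h := hD 1 (by norm_num) t ht
    simp only [iteratedDeriv_one, iteratedDerivWithin_one] at h
    simp only [scaleDeriv, scaleDerivIn, h]
  have h1mem : (1 : ℝ) ∈ Icc (-1 : ℝ) 1 := ⟨by norm_num, le_rfl⟩
  refine ⟨gExt ξ' η, contDiff_gExt hξ' hη, fun x hx ↦ ?_, ?_, ?_, fun x hx ↦ ?_, fun x hx ↦ ?_⟩
  · -- the formula on `x ≥ 0`
    simp only [gExt]
    congr 1
    exact intervalIntegral.integral_congr fun t ht ↦ by
      simp only [hEq (uIcc_exp_neg_subset hx ht)]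
  · -- `g(0) = 0`
    simp [gExt]
  · -- `g′(0) = ξ(1)η(1)`
    rw [(hasDerivAt_gExt hξ'1 hη1 0).deriv]
    simp [gExt, bTerm, hEq h1mem]
  · -- the first-derivative display
    have hI : (∫ t in Real.exp (-x)..1, ξ' t * scaleDeriv η (Real.exp x * t))
        = ∫ t in Real.exp (-x)..1, ξ t * scaleDeriv η (Real.exp x * t) :=
      intervalIntegral.integral_congr fun t ht ↦ by
        simp only [hEq (uIcc_exp_neg_subset hx ht)]
    rw [(hasDerivAt_gExt hξ'1 hη1 x).deriv, bTerm, hEq (exp_neg_mem_Icc hx)]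
    simp only [gExt]
    rw [hI]
  · -- (devil3bis)
    have hI : (∫ t in Real.exp (-x)..1, scaleDeriv ξ' t * scaleDeriv η (Real.exp x * t))
        = ∫ t in Real.exp (-x)..1, scaleDerivIn ξ t * scaleDeriv η (Real.exp x * t) :=
      intervalIntegral.integral_congr fun t ht ↦ by
        simp only [hsD t (uIcc_exp_neg_subset hx ht)]
    rw [opQ_gExt_eq hξ' hη x, hsD _ (exp_neg_mem_Icc hx), hEq h1mem, hI]

/-- **Connes–Consani 2021, Lemma 5.2 (arXiv Lemma 29), as printed, in the variable `ρ`**: for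
`ξ` of class `C²` on `[−1,1]` (cut off outside; `D_uξ = scaleDerivIn ξ` one-sided) and
`η ∈ C²(ℝ)`, the function `k(ρ) = ρ^{1/2}∫_{ρ⁻¹}^1 ξ(t)η(ρt)dt` satisfies, for every `ρ > 1`,
(devil3bis) `(Qk)(ρ) = −(ρ∂_ρ)²k(ρ) + ¼k(ρ)`
`= ρ^{1/2}∫_{ρ⁻¹}^1 (D_uξ)(t)(D_uη)(ρt)dt + ρ^{-1/2}(D_uξ)(ρ⁻¹)η(1) − ρ^{1/2}ξ(1)(D_uη)(ρ)`
(`Q = −(ρ∂_ρ)² + ¼`, eq. (Qop); printed for `ρ ∈ (1, 2]`).  For `ψ` a cut-off prolate function and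
`η = cosTransform ψ`, `2λ(1−λ²)⁻¹` times the right-hand side is `sonineQTerm ψ λ ρ` of
`SeriesRemainderBounds.lean` (Prop. 5.3's term).
[cite: ConnesConsani2021, Lemma 5.2 §5 p. 19 eq. (devil3bis) (arXiv Lemma 29, p0019:L77–L80)] -/
theorem opQ_truncScalingCoeff_eq (hξ : ContDiffOn ℝ 2 ξ (Icc (-1) 1)) (hη : ContDiff ℝ 2 η)
    {ρ : ℝ} (hρ : 1 < ρ) :
    -(ρ * deriv (fun r ↦ r * deriv (fun r ↦ Real.sqrt r * ∫ t in r⁻¹..1, ξ t * η (r * t)) r) ρ)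
      + (Real.sqrt ρ * ∫ t in ρ⁻¹..1, ξ t * η (ρ * t)) / 4 =
      Real.sqrt ρ * (∫ t in ρ⁻¹..1, scaleDerivIn ξ t * scaleDeriv η (ρ * t))
        + (Real.sqrt ρ)⁻¹ * scaleDerivIn ξ ρ⁻¹ * η 1 - Real.sqrt ρ * ξ 1 * scaleDeriv η ρ := by
  obtain ⟨g, hg, hgk, -, -, -, hQ⟩ := exists_contDiff_truncScalingCoeff hξ hη
  have hρ0 : 0 < ρ := by linarith
  -- dictionary `x = log r`
  have hexph : ∀ r : ℝ, 0 < r → Real.exp (Real.log r / 2) = Real.sqrt r := fun r hr ↦ by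
    rw [Real.sqrt_eq_rpow, Real.rpow_def_of_pos hr]
    congr 1
    ring
  have hexpnh : ∀ r : ℝ, 0 < r → Real.exp (-Real.log r / 2) = (Real.sqrt r)⁻¹ := fun r hr ↦ by
    rw [neg_div, Real.exp_neg, hexph r hr]
  have hexpn : ∀ r : ℝ, 0 < r → Real.exp (-Real.log r) = r⁻¹ := fun r hr ↦ by
    rw [Real.exp_neg, Real.exp_log hr]
  -- `k = g ∘ log` on `[1, ∞)`
  set k : ℝ → ℝ := fun r ↦ Real.sqrt r * ∫ t in r⁻¹..1, ξ t * η (r * t) with hk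
  have hkg : ∀ r : ℝ, 1 ≤ r → k r = g (Real.log r) := by
    intro r hr
    have hr0 : 0 < r := by linarith
    simp only [hk]
    rw [hgk _ (Real.log_nonneg hr), hexph r hr0, hexpn r hr0, Real.exp_log hr0]
  -- `k′(r) = g′(log r)/r` on `(1, ∞)`
  have hgd : ∀ y, HasDerivAt g (deriv g y) y := fun y ↦
    (hg.differentiable (by norm_num) y).hasDerivAt
  have hg'd : ∀ y, HasDerivAt (deriv g) (deriv (deriv g) y) y := fun y ↦
    ((contDiff_one_deriv hg).differentiable one_ne_zero y).hasDerivAt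
  have hkd : ∀ r : ℝ, 1 < r → deriv k r = deriv g (Real.log r) * r⁻¹ := by
    intro r hr
    have hr0 : 0 < r := by linarith
    have hloc : k =ᶠ[𝓝 r] fun s ↦ g (Real.log s) := by
      filter_upwards [Ioi_mem_nhds hr] with s hs using hkg s (le_of_lt hs)
    rw [hloc.deriv_eq]
    have h := (hgd (Real.log r)).comp r (Real.hasDerivAt_log hr0.ne')
    simpa [Function.comp_def] using h.deriv
  -- `(ρ∂_ρ)²k(ρ) = g″(log ρ)`
  have hloc2 : (fun r ↦ r * deriv k r) =ᶠ[𝓝 ρ] fun r ↦ deriv g (Real.log r) := by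
    filter_upwards [Ioi_mem_nhds hρ] with s hs
    have hs0 : s ≠ 0 := by
      have : (1 : ℝ) < s := hs
      positivity
    rw [hkd s hs]
    field_simp
  have h2 : deriv (fun r ↦ r * deriv k r) ρ = deriv (deriv g) (Real.log ρ) * ρ⁻¹ := by
    rw [hloc2.deriv_eq]
    have h := (hg'd (Real.log ρ)).comp ρ (Real.hasDerivAt_log hρ0.ne')
    simpa [Function.comp_def] using h.deriv
  have hkρ : Real.sqrt ρ * ∫ t in ρ⁻¹..1, ξ t * η (ρ * t) = g (Real.log ρ) := hkg ρ hρ.le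
  rw [h2, hkρ]
  have h3 : ρ * (deriv (deriv g) (Real.log ρ) * ρ⁻¹) = deriv (deriv g) (Real.log ρ) := by
    field_simp
  rw [h3, hQ _ (Real.log_nonneg hρ.le), hexph ρ hρ0, hexpnh ρ hρ0, hexpn ρ hρ0, Real.exp_log hρ0]

end Public

end Literature.NumberTheory.ConnesConsani2021

end
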